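import Literature.NumberTheory.Transcendental.KZCalculus
import Summits.KontsevichZagierPeriods.KontsevichZagierPeriods.Theorems.HyperbolicBlochIsometryMoveSimilarity

/-!
# `CyclicCalibration` (route HyperbolicBloch, stmt-KontsevichZagierPeriods-3475)

The two standard ideal tetrahedra `T(i)` (vertices `∞, 0, 1, i`) and `T((1+i)/2)` (vertices
`∞, 0, 1, (1+i)/2`) of the upper half-space `ℍ³ = {(x, y, t) | t > 0}`, each carrying the
hyperbolic volume density `t⁻³`, are equivalent in the Kontsevich–Zagier calculus of moves.

The route informal text relabels the tetrahedron by the Möbius map `w ↦ 1/(1 − w)` (an inversion).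
We use instead the elementary observation that the boundary triangles `(0, 1, i)` and
`(0, 1, (1+i)/2)` are SIMILAR (both are right isosceles: right angle at `0`, resp. at `(1+i)/2`),
so the orientation-preserving similarity of `ℂ`

`w ↦ (1 + i)(1 − w)/2`, i.e. `0 ↦ (1+i)/2`, `1 ↦ 0`, `i ↦ 1`,

extended to `ℍ³` by `t ↦ |(1+i)/2|·t = t/√2`, maps `T(i)` onto `T((1+i)/2)`. In coordinates this is
the boundary-fixing similarity `S(α, β, 1)` of `HyperbolicBlochIsometryMoveSimilarity.lean` with
`α = −(1+i)/2`, `β = (1+i)/2`: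

`S (x, y, t) = ((1 − x + y)/2, (1 − x − y)/2, ‖α‖·t)`, `‖α‖² = 1/2`.

`stub_similarityMove` supplies the four analytic data of KZ's rule (2) (semialgebraicity over `ℚ` —
`α` is algebraic —, injectivity, the derivative and the Jacobian identity
`t⁻³ = ((S p)₂)⁻³ · |det DS|`), so `[r] − [r']` is ONE change-of-variables generator once the set
identity `S '' T(i) = T((1+i)/2)` is checked (`image_simil`, elementary linear/quadratic algebra
with the explicit inverse `(x, y, t) ↦ (1 − x − y, x − y, t/‖α‖)`).

The statement proved (`cyclicCalibration`) is, verbatim, the body of the route declaration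
`Summit.KontsevichZagierPeriods.KontsevichZagierPeriods.Theses.HyperbolicBloch.CyclicCalibration`;
this module deliberately does NOT import the Theses file (cycle-free, so that the route file can
link it).

References: M. Kontsevich, D. Zagier, *Periods* (2001), §1.2 rule (2); J. Milnor, *Hyperbolic
geometry: the first 150 years* (1982), Appendix; R. Benedetti, C. Petronio, *Lectures on
Hyperbolic Geometry* (1992), A.3.5.
-/

noncomputable section

open Set MeasureTheory
open Literature.NumberTheory.Transcendental Literature.NumberTheory.Transcendental.KZ
open Literature.ModelTheory.ExponentialFields (IsSemialgebraic)
open Summit.KontsevichZagierPeriods.HyperbolicBloch.IsometryMove (stub_similarityMove)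

namespace Summit.KontsevichZagierPeriods.HyperbolicBloch.CyclicCalibration

/-- **One hyperbolic move.** If `Φ` is, on `r.domain ⊆ {t > 0}`, a `ℚ`-semialgebraic injective map
with derivative `Φ'` satisfying the Jacobian identity `t⁻³ = ((Φ p)₂)⁻³ · |det Φ' p|`, and
`r'.domain = Φ '' r.domain`, both integrands being `t⁻³` on their domains, then `r` and `r'` are
KZ-equivalent by a single change-of-variables generator. [cite: KontsevichZagier2001, §1.2 rule (2)] -/
theorem equivalent_of_jacobian_move {r r' : IntegralRep 3} (Φ : (Fin 3 → ℝ) → (Fin 3 → ℝ))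
    (Φ' : (Fin 3 → ℝ) → (Fin 3 → ℝ) →L[ℝ] (Fin 3 → ℝ))
    (hΦ : IsSemialgebraicMapOn ℚ r.domain Φ)
    (hd : ∀ x ∈ r.domain, HasFDerivWithinAt Φ (Φ' x) r.domain x) (hinj : InjOn Φ r.domain)
    (himg : r'.domain = Φ '' r.domain)
    (hjac : ∀ x ∈ r.domain, 1 / x 2 ^ 3 = 1 / (Φ x) 2 ^ 3 * |(Φ' x).det|)
    (hr : EqOn r.integrand (fun p => 1 / p 2 ^ 3) r.domain)
    (hr' : EqOn r'.integrand (fun p => 1 / p 2 ^ 3) r'.domain) : Equivalent r r' := by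
  refine changeOfVariablesRel_subset_relations ⟨3, r, r', Φ, Φ', hΦ, hd, hinj, himg, ?_, rfl⟩
  intro x hx
  have hx' : Φ x ∈ r'.domain := himg ▸ mem_image_of_mem Φ hx
  have h1 : r.integrand x = 1 / x 2 ^ 3 := hr hx
  have h2 : r'.integrand (Φ x) = 1 / (Φ x) 2 ^ 3 := hr' hx'
  rw [h1, h2]
  exact hjac x hx

/-- The scale `‖α‖` of the similarity, `α = −(1+i)/2`: `‖α‖² = 1/2`. [folklore] -/
theorem norm_alpha_sq : ‖(⟨-1 / 2, -1 / 2⟩ : ℂ)‖ ^ 2 = 1 / 2 := by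
  rw [Complex.sq_norm, Complex.normSq_mk]
  norm_num

/-- The scale `‖α‖` of the similarity is positive. [folklore] -/
theorem norm_alpha_pos : 0 < ‖(⟨-1 / 2, -1 / 2⟩ : ℂ)‖ := by
  refine norm_pos_iff.mpr ?_
  intro h
  have := congrArg Complex.re h
  norm_num at this

/-- `α = −(1+i)/2` is algebraic (a Gaussian rational). [folklore] -/
theorem isAlgebraic_alpha : IsAlgebraic ℚ (⟨-1 / 2, -1 / 2⟩ : ℂ) := by
  have hI : IsAlgebraic ℚ Complex.I :=
    ⟨Polynomial.X ^ 2 + 1, Polynomial.Monic.ne_zero (by monicity!), by simp⟩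
  have h : (⟨-1 / 2, -1 / 2⟩ : ℂ) = ((-1 / 2 : ℚ) : ℂ) + ((-1 / 2 : ℚ) : ℂ) * Complex.I := by
    apply Complex.ext <;> simp
  rw [h]
  exact (isAlgebraic_algebraMap (R := ℚ) (A := ℂ) (-1 / 2 : ℚ)).add
    ((isAlgebraic_algebraMap (R := ℚ) (A := ℂ) (-1 / 2 : ℚ)).mul hI)

/-- `β = (1+i)/2` is algebraic (a Gaussian rational). [folklore] -/
theorem isAlgebraic_beta : IsAlgebraic ℚ (⟨1 / 2, 1 / 2⟩ : ℂ) := by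
  have hI : IsAlgebraic ℚ Complex.I :=
    ⟨Polynomial.X ^ 2 + 1, Polynomial.Monic.ne_zero (by monicity!), by simp⟩
  have h : (⟨1 / 2, 1 / 2⟩ : ℂ) = ((1 / 2 : ℚ) : ℂ) + ((1 / 2 : ℚ) : ℂ) * Complex.I := by
    apply Complex.ext <;> simp
  rw [h]
  exact (isAlgebraic_algebraMap (R := ℚ) (A := ℂ) (1 / 2 : ℚ)).add
    ((isAlgebraic_algebraMap (R := ℚ) (A := ℂ) (1 / 2 : ℚ)).mul hI)

/-- The similarity `S(α, β, 1)`, `α = −(1+i)/2`, `β = (1+i)/2`, in coordinates: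
`S (x, y, t) = ((1 − x + y)/2, (1 − x − y)/2, ‖α‖ t)`. [folklore] -/
theorem simil_apply (S : (Fin 3 → ℝ) → (Fin 3 → ℝ))
    (hS : ∀ p, S p = ![((⟨-1 / 2, -1 / 2⟩ : ℂ) * (Complex.mk (p 0) (1 * p 1)) + ⟨1 / 2, 1 / 2⟩).re,
      ((⟨-1 / 2, -1 / 2⟩ : ℂ) * (Complex.mk (p 0) (1 * p 1)) + ⟨1 / 2, 1 / 2⟩).im,
      ‖(⟨-1 / 2, -1 / 2⟩ : ℂ)‖ * p 2]) (p : Fin 3 → ℝ) :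
    S p 0 = (1 - p 0 + p 1) / 2 ∧ S p 1 = (1 - p 0 - p 1) / 2 ∧
      S p 2 = ‖(⟨-1 / 2, -1 / 2⟩ : ℂ)‖ * p 2 := by
  refine ⟨?_, ?_, ?_⟩
  · rw [hS, Matrix.cons_val_zero, Complex.add_re, Complex.mul_re]
    ring
  · rw [hS, Matrix.cons_val_one, Matrix.cons_val_zero, Complex.add_im, Complex.mul_im]
    ring
  · rw [hS, Matrix.cons_val_two, Matrix.tail_cons, Matrix.head_cons]

/-- **The similarity maps `T(i)` onto `T((1+i)/2)`** (both written out in coordinates exactly as in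
the route item): the five defining inequalities are permuted/rescaled into each other, and the
inverse similarity `(x, y, t) ↦ (1 − x − y, x − y, t/‖α‖)` gives surjectivity.
[cite: Milnor1982, Appendix (the ideal tetrahedron over a triangle)] -/
theorem image_simil (S : (Fin 3 → ℝ) → (Fin 3 → ℝ))
    (hS : ∀ p, S p = ![((⟨-1 / 2, -1 / 2⟩ : ℂ) * (Complex.mk (p 0) (1 * p 1)) + ⟨1 / 2, 1 / 2⟩).re,
      ((⟨-1 / 2, -1 / 2⟩ : ℂ) * (Complex.mk (p 0) (1 * p 1)) + ⟨1 / 2, 1 / 2⟩).im,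
      ‖(⟨-1 / 2, -1 / 2⟩ : ℂ)‖ * p 2]) :
    S '' {p : Fin 3 → ℝ | 0 < p 1 ∧ 0 < p 0 ∧ p 0 - 1 < -p 1 ∧ 0 < p 2 ∧
        0 < p 0 ^ 2 + p 1 ^ 2 + p 2 ^ 2 - p 0 - p 1} =
      {p : Fin 3 → ℝ | 0 < p 1 ∧ p 1 < p 0 ∧ p 0 - 1 < -p 1 ∧ 0 < p 2 ∧
        0 < p 0 ^ 2 + p 1 ^ 2 + p 2 ^ 2 - p 0} := by
  set c : ℝ := ‖(⟨-1 / 2, -1 / 2⟩ : ℂ)‖ with hc_def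
  have hc2 : c ^ 2 = 1 / 2 := norm_alpha_sq
  have hc : 0 < c := norm_alpha_pos
  apply Subset.antisymm
  · rintro _ ⟨p, ⟨h1, h2, h3, h4, h5⟩, rfl⟩
    obtain ⟨e0, e1, e2⟩ := simil_apply S hS p
    simp only [mem_setOf_eq, e0, e1, e2]
    refine ⟨by linarith, by linarith, by linarith, mul_pos hc h4, ?_⟩
    have key : ((1 - p 0 + p 1) / 2) ^ 2 + ((1 - p 0 - p 1) / 2) ^ 2 + (c * p 2) ^ 2 -
        (1 - p 0 + p 1) / 2 = (p 0 ^ 2 + p 1 ^ 2 + p 2 ^ 2 - p 0 - p 1) / 2 := by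
      have : (c * p 2) ^ 2 = p 2 ^ 2 / 2 := by rw [mul_pow, hc2]; ring
      rw [this]; ring
    rw [key]
    linarith
  · rintro q ⟨h1, h2, h3, h4, h5⟩
    refine ⟨![1 - q 0 - q 1, q 0 - q 1, q 2 / c], ?_, ?_⟩
    · simp only [mem_setOf_eq, Matrix.cons_val_zero, Matrix.cons_val_one, Matrix.head_cons,
        Matrix.cons_val_two, Matrix.tail_cons]
      refine ⟨by linarith, by linarith, by linarith, div_pos h4 hc, ?_⟩
      have key : (1 - q 0 - q 1) ^ 2 + (q 0 - q 1) ^ 2 + (q 2 / c) ^ 2 - (1 - q 0 - q 1) -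
          (q 0 - q 1) = 2 * (q 0 ^ 2 + q 1 ^ 2 + q 2 ^ 2 - q 0) := by
        have : (q 2 / c) ^ 2 = 2 * q 2 ^ 2 := by
          rw [div_pow, hc2]; ring
        rw [this]; ring
      rw [key]
      linarith
    · obtain ⟨e0, e1, e2⟩ := simil_apply S hS ![1 - q 0 - q 1, q 0 - q 1, q 2 / c]
      simp only [Matrix.cons_val_zero, Matrix.cons_val_one, Matrix.head_cons, Matrix.cons_val_two,
        Matrix.tail_cons] at e0 e1 e2
      funext i
      fin_cases i
      · simp only [Fin.zero_eta]
        rw [e0]; ring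
      · simp only [Fin.mk_one]
        rw [e1]; ring
      · simp only [Fin.reduceFinMk]
        rw [e2, ← hc_def]
        field_simp

/-- **`CyclicCalibration`** (route HyperbolicBloch, item stmt-KontsevichZagierPeriods-3475), verbatim
the body of `Summit.KontsevichZagierPeriods.KontsevichZagierPeriods.Theses.HyperbolicBloch.CyclicCalibration`:
any KZ representations `r` on `T(i)` and `r'` on `T((1+i)/2)` with integrand `t⁻³` on their domains
are KZ-equivalent — by ONE change-of-variables move, the boundary-fixing similarity
`w ↦ (1+i)(1 − w)/2`, `t ↦ t/√2` (`stub_similarityMove` with `α = −(1+i)/2`, `β = (1+i)/2`, `η = 1`),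
which maps `T(i)` onto `T((1+i)/2)` (`image_simil`). Both values equal Catalan's constant
`G = D(i) = D((1+i)/2)` (not used). [cite: KontsevichZagier2001, §1.2 rule (2)] -/
theorem cyclicCalibration : ∀ (r r' : Literature.NumberTheory.Transcendental.KZ.IntegralRep 3), r.domain = {p | 0 < p 1 ∧ 0 < p 0 ∧ p 0 - 1 < -p 1 ∧ 0 < p 2 ∧ 0 < p 0 ^ 2 + p 1 ^ 2 + p 2 ^ 2 - p 0 - p 1} → r'.domain = {p | 0 < p 1 ∧ p 1 < p 0 ∧ p 0 - 1 < -p 1 ∧ 0 < p 2 ∧ 0 < p 0 ^ 2 + p 1 ^ 2 + p 2 ^ 2 - p 0} → Set.EqOn r.integrand (fun p => 1 / p 2 ^ 3) r.domain → Set.EqOn r'.integrand (fun p => 1 / p 2 ^ 3) r'.domain → Literature.NumberTheory.Transcendental.KZ.Equivalent r r' := by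
  intro r r' hr hr' hi hi'
  -- the similarity `S(α, β, 1)`
  set S : (Fin 3 → ℝ) → (Fin 3 → ℝ) := fun p =>
    ![((⟨-1 / 2, -1 / 2⟩ : ℂ) * (Complex.mk (p 0) (1 * p 1)) + ⟨1 / 2, 1 / 2⟩).re,
      ((⟨-1 / 2, -1 / 2⟩ : ℂ) * (Complex.mk (p 0) (1 * p 1)) + ⟨1 / 2, 1 / 2⟩).im,
      ‖(⟨-1 / 2, -1 / 2⟩ : ℂ)‖ * p 2] with hS_def
  have hS : ∀ p, S p = ![((⟨-1 / 2, -1 / 2⟩ : ℂ) * (Complex.mk (p 0) (1 * p 1)) + ⟨1 / 2, 1 / 2⟩).re,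
      ((⟨-1 / 2, -1 / 2⟩ : ℂ) * (Complex.mk (p 0) (1 * p 1)) + ⟨1 / 2, 1 / 2⟩).im,
      ‖(⟨-1 / 2, -1 / 2⟩ : ℂ)‖ * p 2] := fun p => rfl
  have hpos : r.domain ⊆ {p | 0 < p 2} := by
    rw [hr]
    exact fun p hp => hp.2.2.2.1
  have hα0 : (⟨-1 / 2, -1 / 2⟩ : ℂ) ≠ 0 := norm_pos_iff.mp norm_alpha_pos
  obtain ⟨hsemi, hinj, -, S', hS'⟩ := stub_similarityMove _ _ 1 isAlgebraic_alpha isAlgebraic_beta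
    hα0 (Or.inl rfl) S hS r.domain r.isSemialgebraic_domain hpos
  refine equivalent_of_jacobian_move S S' hsemi (fun x hx => (hS' x hx).1) hinj ?_
    (fun x hx => (hS' x hx).2) hi hi'
  rw [hr', hr, image_simil S hS]

end Summit.KontsevichZagierPeriods.HyperbolicBloch.CyclicCalibration

end
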